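import Summits.Ventures.YMGap.FlowData.JointCharacterTruncation
import Summits.Ventures.YMGap.FlowData.SU2WeightCharacterSeries
import HarnessLib

/-!
# Venture YMGap, track Y3 FLOW-DATA — the joint character-truncation tail instantiated for the `SU(2)` Wilson plaquette weight

HONEST FRAMING: venture file of the cell `pub-ymgap`, track Y3, lineage C (engine-3).  A short corollary file: the abstract joint tail of
`FlowData/JointCharacterTruncation` (`prod_mem_Icc_truncProd`) fed with the single-plaquette `SU(2)` facts of
`FlowData/SU2WeightCharacterSeries` (the character series `e^{b a₀(X)} = Σ_n (I_n(b) − I_{n+2}(b)) χ_n(X)`, `|χ_n| ≤ n + 1`): terms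
`a_n(X) = c_n(b) χ_n(X)`, majorants `t_n = (n+1) c_n(b)`, `B = e^b`, single tails `Σ_{n>L} t_n` (the same fact as lineage A's
`PlaquetteCharacterTail.abs_weight_sub_truncWeight_le`, restated in this vocabulary because that module's object file is not available on the
build farm at filing time).  Result `su2_prod_weight_mem_Icc_truncProd`: for every list of plaquette variables `X₁,…,X_k ∈ SU(2)` and every label
budget `L`, `Π_i e^{b a₀(X_i)}` lies within `e^{kb} − keptSum t k L` of the jointly truncated product `truncProd a L [X₁,…,X_k]` — the pointwise
bracket behind lineage C's `Λ = 1³` standard-certificate step S3 (`engine/sce/CERT-CHAIN-C.md`), consumed by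
`GalerkinWeightMonotone.eigenvalues₀_sandwich_of_pointwise`.  No lattice, no number of record, nothing about limits or a mass gap.
References: Montvay–Münster (1994) §3.2.6 [cite: MontvayMunster1994, §3.2.6].
-/

noncomputable section

open Finset Polynomial.Chebyshev
open scoped BigOperators
open Summit.Ventures.LatticeQCDFlow.Exactness
open Summit.Ventures.YMGap.FlowData
open Literature.Analysis.FunctionSpaces

namespace Summit.Ventures.YMGap.FlowData.JointCharacterTruncation

/-- The `n`-th character term of the `SU(2)` plaquette weight, `a_n(X) = (I_n(b) − I_{n+2}(b)) χ_n(X)`. [cite: MontvayMunster1994, §3.2.6] -/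
def su2Term (b : ℝ) (n : ℕ) (X : Matrix.specialUnitaryGroup (Fin 2) ℂ) : ℝ :=
  (besselI n b - besselI (n + 2) b) * (U ℝ n).eval (su2a0 X)

/-- Its sup-norm majorant `t_n = (n+1)(I_n(b) − I_{n+2}(b))`. [cite: MontvayMunster1994, §3.2.6] -/
def su2Major (b : ℝ) (n : ℕ) : ℝ := ((n : ℝ) + 1) * (besselI n b - besselI (n + 2) b)

/-- `t_n ≥ 0` for `b ≥ 0`. [folklore] -/
theorem su2Major_nonneg {b : ℝ} (hb : 0 ≤ b) (n : ℕ) : 0 ≤ su2Major b n :=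
  mul_nonneg (by positivity) (besselISub_nonneg hb n)

/-- `|a_n(X)| ≤ t_n` (`|χ_n| ≤ n + 1`, `I_n − I_{n+2} ≥ 0`). [cite: MontvayMunster1994, §3.2.6] -/
theorem abs_su2Term_le {b : ℝ} (hb : 0 ≤ b) (n : ℕ) (X : Matrix.specialUnitaryGroup (Fin 2) ℂ) :
    |su2Term b n X| ≤ su2Major b n := by
  rw [su2Term, su2Major, abs_mul, abs_of_nonneg (besselISub_nonneg hb n), mul_comm]
  exact mul_le_mul_of_nonneg_right (by exact_mod_cast abs_su2Character_le n X) (besselISub_nonneg hb n)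

/-- `Σ_n (n+1)(I_n(b) − I_{n+2}(b)) = e^{b}` (`b ≥ 0`): the character series at the identity, `χ_n(1) = n + 1`. [cite: MontvayMunster1994, §3.2.6] -/
theorem hasSum_su2Major {b : ℝ} (hb : 0 ≤ b) : HasSum (su2Major b) (Real.exp b) := by
  have h := hasSum_besselISub_mul_chebyshevU hb (t := 1) (by simp)
  rw [mul_one] at h
  refine h.congr_fun fun n => ?_
  show su2Major b n = (besselI n b - besselI (n + 2) b) * (U ℝ n).eval 1
  rw [su2Major, U_eval_one, mul_comm]
  push_cast; ring

/-- The single-plaquette tail in this vocabulary: `|e^{b a₀(X)} − Σ_{n ≤ L} a_n(X)| ≤ Σ_{n > L} t_n`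
(= lineage A's `PlaquetteCharacterTail.abs_weight_sub_truncWeight_le` with `N = L + 1`). [cite: MontvayMunster1994, §3.2.6] -/
theorem abs_weight_sub_sum_su2Term_le {b : ℝ} (hb : 0 ≤ b) (L : ℕ) (X : Matrix.specialUnitaryGroup (Fin 2) ℂ) :
    |Real.exp (b * su2a0 X) - ∑ n ∈ range (L + 1), su2Term b n X| ≤ ∑' n, su2Major b (n + (L + 1)) := by
  have hs := hasSum_besselISub_mul_su2Character hb X
  have hshift : HasSum (fun n : ℕ => su2Term b (n + (L + 1)) X)
      (Real.exp (b * su2a0 X) - ∑ n ∈ range (L + 1), su2Term b n X) := by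
    exact (hasSum_nat_add_iff' (L + 1)).2 hs
  have hmaj : Summable fun n : ℕ => su2Major b (n + (L + 1)) :=
    (summable_nat_add_iff (L + 1)).2 (summable_succ_mul_besselISub hb)
  rw [← hshift.tsum_eq, ← Real.norm_eq_abs]
  refine (norm_tsum_le_tsum_norm hshift.summable.norm).trans ?_
  refine hshift.summable.norm.tsum_le_tsum (fun n => ?_) hmaj
  rw [Real.norm_eq_abs]
  exact abs_su2Term_le hb _ X

/-- ★ **Joint character-truncation bracket for `SU(2)` plaquette weights.**  For `b ≥ 0`, every list of plaquette variables and every label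
budget `L`: `Π_i e^{b a₀(X_i)} ∈ [truncProd − τ, truncProd + τ]` with `τ = (e^b)^k − keptSum (su2Major b) k L`, `k` = the number of plaquettes
(the engine's `τ_N = 1 − Σ_{Σ2J_p ≤ N} Π_p κ(2J_p+1)² a_{J_p}` after dividing by `(e^b)^k`). [cite: MontvayMunster1994, §3.2.6] -/
theorem su2_prod_weight_mem_Icc_truncProd {b : ℝ} (hb : 0 ≤ b) (xs : List (Matrix.specialUnitaryGroup (Fin 2) ℂ)) (L : ℕ) :
    (xs.map fun X => Real.exp (b * su2a0 X)).prod ∈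
      Set.Icc (truncProd (su2Term b) L xs - (Real.exp b ^ xs.length - keptSum (su2Major b) xs.length L))
              (truncProd (su2Term b) L xs + (Real.exp b ^ xs.length - keptSum (su2Major b) xs.length L)) := by
  refine prod_mem_Icc_truncProd (hasSum_su2Major hb) (fun X => ?_) (fun n X => abs_su2Term_le hb n X)
    (fun L X => abs_weight_sub_sum_su2Term_le hb L X) xs L
  -- |e^{b a₀}| ≤ e^b since a₀ ≤ 1
  rw [abs_of_nonneg (Real.exp_pos _).le]
  have h := (abs_le.1 (abs_su2a0_le_one X)).2
  exact Real.exp_le_exp.2 (by nlinarith)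

/-- The joint tail is non-negative: `keptSum (su2Major b) k L ≤ (e^b)^k`. [folklore] -/
theorem keptSum_su2Major_le_exp_pow {b : ℝ} (hb : 0 ≤ b) (k L : ℕ) :
    keptSum (su2Major b) k L ≤ Real.exp b ^ k := by
  have h := tailBound_nonneg (τ := fun L => ∑' n, su2Major b (n + (L + 1))) (t := su2Major b) (B := Real.exp b)
    (fun L => tsum_nonneg fun n => su2Major_nonneg hb _) (su2Major_nonneg hb) (Real.exp_pos b).le k L
  rw [tailBound_eq_pow_sub_keptSum (fun L => tsum_shift_eq_sub_sum (hasSum_su2Major hb) L)] at h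
  linarith

end Summit.Ventures.YMGap.FlowData.JointCharacterTruncation

end
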